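import Literature.MathematicalPhysics.KineticTheory.LangevinChainGibbs
import Literature.MathematicalPhysics.KineticTheory.HarmonicChainCovariance
import HarnessLib

/-!
# Gaussian densities on phase space: the generator against `e^{-xᵀBx/2}` (integration by parts)

Trunk T-KINETIC (Literature/MathematicalPhysics/KineticTheory). Second decomposition step for the
named fact `Literature.Barriers.AtomisticToContinuum.HarmonicChainBallisticFlux`
(`Literature/Barriers/AtomisticToContinuum/HarmonicCrystalBallistic.lean`; provefact unit):
the MEASURE-THEORETIC identity behind "the stationary measure is Gaussian"
(Bonetto–Lebowitz–Rey-Bellet 2000, §6.2; Rieder–Lebowitz–Lieb 1967; Dhar 2008, §3.1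
"`P({q_l}) = (2π)^{-N} Det[B]^{-1/2} e^{-½ qᵀ B⁻¹ q}`").

For an oscillator chain `P` (`FouriersLaw.lean`) with `C¹` potentials and ANY symmetric matrix
`B` on the flat phase-space coordinates `x♭ = (q, p) ∈ ℝ^{N ⊕ N}`, we compute the generator
`L = L_{T_L,T_R}` of `FouriersLaw.lean` against the Gaussian-type density
`ρ_B(x) = e^{-x♭ᵀ B x♭ / 2}` by two integrations by parts per site (Mathlib's
`integral_bilinear_hasLineDerivAt_right_eq_neg_left_of_integrable`, through the wrapper
`integral_mul_eq_neg_of_hasLineDerivAt` of `LangevinChainGibbs.lean`), exactly as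
`LangevinChainGibbs.lean` does for `e^{-H/T}`:

* `integral_liouville_mul_gaussDensity`:
  `∫ (p_i ∂_{q_i} f - ∂_{q_i}H ∂_{p_i} f) ρ_B = ∫ (p_i (Bx♭)_{q_i} - ∂_{q_i}H (Bx♭)_{p_i}) ρ_B f`;
* `integral_bath_mul_gaussDensity`:
  `∫ (T_b ∂²_{p_i} f - p_i ∂_{p_i} f) ρ_B = ∫ (1 - p_i (Bx♭)_{p_i} - T_b (B_{p_i p_i} - (Bx♭)_{p_i}²)) ρ_B f`;
* `integral_generator_mul_gaussDensity`: hence `∫ (L f) ρ_B = ∫ (L*_B) ρ_B f` with the explicit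
  polynomial `adjointPoly` (the formal adjoint `L*` applied to `ρ_B`, divided by `ρ_B`).

So `ρ_B dx` is weakly stationary iff the quadratic polynomial `adjointPoly` vanishes; for the
HARMONIC chain and `B⁻¹` = the solution of the Lyapunov equation this is a matrix identity,
discharged in `HarmonicChainNESS.lean`. Also here: the flat coordinates `flat`, the coordinate
directions `coordVec`, the line derivatives of `x♭ᵀBx♭`, `ρ_B`, `x♭_a` and `(Bx♭)_a`.

## References

* F. Bonetto, J. L. Lebowitz, L. Rey-Bellet, *Fourier's law: a challenge to theorists* (2000),
  §4.1 eq. (10) (the generator), §6.2 (Gaussian stationary measure of the harmonic crystal).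
* A. Dhar, *Heat transport in low-dimensional systems*, Adv. Phys. 57 (2008), §3.1.
* N. Cuneo, J.-P. Eckmann, M. Hairer, L. Rey-Bellet, EJP 23 (2018) no. 55, §3.1 (proof of
  Prop. 3.3: invariance is `L* ρ = 0` for the formal adjoint `L*`).

## Design choices

* `B` is an arbitrary matrix on `Fin N ⊕ Fin N` (positions `inl`, momenta `inr`, the indexing of
  `HarmonicChainCovariance.lean`); symmetry `Bᵀ = B` is the only hypothesis of the identities,
  positivity enters only later (integrability).
* Test functions: `f ∈ C²_c` (the steady-state predicate quantifies over `C_c^∞`).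
* Nothing here is specific to the harmonic chain; the file is the Gaussian analogue of the
  Gibbs computation of `LangevinChainGibbs.lean` and reuses its wrapper lemma.
-/

noncomputable section

open MeasureTheory Matrix
open scoped ContDiff

namespace Literature.MathematicalPhysics.KineticTheory.HeatConduction

variable {N : ℕ}

/-! ### Flat coordinates `x♭ = (q, p)` and the coordinate directions -/

/-- The flat coordinate vector `x♭ = (q, p) : Fin N ⊕ Fin N → ℝ` of a phase-space point
`x = (q, p)` (positions on `inl`, momenta on `inr`). [folklore] -/
def flat (x : PhaseSpace N) : Fin N ⊕ Fin N → ℝ := Sum.elim x.1 x.2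

/-- `x♭ (inl i) = q_i`. [folklore] -/
@[simp] theorem flat_inl (x : PhaseSpace N) (i : Fin N) : flat x (Sum.inl i) = x.1 i := rfl

/-- `x♭ (inr i) = p_i`. [folklore] -/
@[simp] theorem flat_inr (x : PhaseSpace N) (i : Fin N) : flat x (Sum.inr i) = x.2 i := rfl

/-- `flat` is additive. [folklore] -/
theorem flat_add (x y : PhaseSpace N) : flat (x + y) = flat x + flat y := by
  ext a; rcases a with i | i <;> rfl

/-- `flat` is homogeneous. [folklore] -/
theorem flat_smul (t : ℝ) (x : PhaseSpace N) : flat (t • x) = t • flat x := by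
  ext a; rcases a with i | i <;> rfl

/-- Each flat coordinate is a continuous function on phase space. [folklore] -/
theorem continuous_flat_apply (a : Fin N ⊕ Fin N) : Continuous fun x : PhaseSpace N => flat x a := by
  rcases a with i | i
  · exact (continuous_apply i).comp continuous_fst
  · exact (continuous_apply i).comp continuous_snd

/-- `x ↦ (B x♭)_a = ∑_b B_{ab} x♭_b` is continuous. [folklore] -/
theorem continuous_mulVec_flat_apply (B : Matrix (Fin N ⊕ Fin N) (Fin N ⊕ Fin N) ℝ)
    (a : Fin N ⊕ Fin N) : Continuous fun x : PhaseSpace N => (B *ᵥ flat x) a := by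
  show Continuous fun x : PhaseSpace N => ∑ b, B a b * flat x b
  exact continuous_finsetSum _ fun b _ => continuous_const.mul (continuous_flat_apply b)

/-- The coordinate directions of phase space indexed by `Fin N ⊕ Fin N`:
`E_{inl i} = (e_i, 0)` (position `q_i`), `E_{inr i} = (0, e_i)` (momentum `p_i`). [folklore] -/
def coordVec : Fin N ⊕ Fin N → PhaseSpace N :=
  Sum.elim (fun i => ((Pi.single i 1, 0) : PhaseSpace N)) (fun i => ((0, Pi.single i 1) : PhaseSpace N))

/-- `E_{inl i} = (e_i, 0)`. [folklore] -/
@[simp] theorem coordVec_inl (i : Fin N) : coordVec (Sum.inl i) = ((Pi.single i 1, 0) : PhaseSpace N) :=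
  rfl

/-- `E_{inr i} = (0, e_i)`. [folklore] -/
@[simp] theorem coordVec_inr (i : Fin N) : coordVec (Sum.inr i) = ((0, Pi.single i 1) : PhaseSpace N) :=
  rfl

/-- The flat coordinates of a coordinate direction: `(E_c)♭ = e_c`. [folklore] -/
theorem flat_coordVec (c : Fin N ⊕ Fin N) : flat (coordVec c : PhaseSpace N) = Pi.single c 1 := by
  ext a
  rcases c with j | j <;> rcases a with i | i
  · simp [flat, Pi.single_apply]
  · simp [flat]
  · simp [flat]
  · simp [flat, Pi.single_apply]

/-- `(x + t E_c)♭ = x♭ + t e_c`. [folklore] -/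
theorem flat_add_smul_coordVec (x : PhaseSpace N) (t : ℝ) (c : Fin N ⊕ Fin N) :
    flat (x + t • coordVec c) = flat x + t • Pi.single c 1 := by
  rw [flat_add, flat_smul, flat_coordVec]

/-- The flat coordinate `x♭_a` has line derivative `[a = c]` along `E_c`. [folklore] -/
theorem hasLineDerivAt_flat_apply (x : PhaseSpace N) (a c : Fin N ⊕ Fin N) :
    HasLineDerivAt ℝ (fun y : PhaseSpace N => flat y a) (if a = c then 1 else 0) x (coordVec c) := by
  unfold HasLineDerivAt
  have h : (fun t : ℝ => flat (x + t • coordVec c) a) = fun t => flat x a + t * (if a = c then 1 else 0) := by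
    funext t
    rw [flat_add_smul_coordVec, Pi.add_apply, Pi.smul_apply, Pi.single_apply, smul_eq_mul]
  rw [h]
  have := ((hasDerivAt_id' (0 : ℝ)).mul_const (if a = c then (1 : ℝ) else 0)).const_add (flat x a)
  simpa using this

/-- `(B y♭)_a` has line derivative `B_{ac}` along `E_c`. [folklore] -/
theorem hasLineDerivAt_mulVec_flat_apply (B : Matrix (Fin N ⊕ Fin N) (Fin N ⊕ Fin N) ℝ)
    (x : PhaseSpace N) (a c : Fin N ⊕ Fin N) :
    HasLineDerivAt ℝ (fun y : PhaseSpace N => (B *ᵥ flat y) a) (B a c) x (coordVec c) := by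
  unfold HasLineDerivAt
  have h : (fun t : ℝ => (B *ᵥ flat (x + t • coordVec c)) a) = fun t => (B *ᵥ flat x) a + t * B a c := by
    funext t
    rw [flat_add_smul_coordVec, mulVec_add, mulVec_smul, Pi.add_apply, Pi.smul_apply,
      mulVec_single_one, smul_eq_mul]
    rfl
  rw [h]
  have := ((hasDerivAt_id' (0 : ℝ)).mul_const (B a c)).const_add ((B *ᵥ flat x) a)
  simpa using this

/-! ### The quadratic form `x♭ᵀ B x♭` and the Gaussian-type density `ρ_B = e^{-x♭ᵀBx♭/2}` -/

/-- The quadratic form `x♭ ⬝ (B x♭)` of a matrix `B` on the flat coordinates. [folklore] -/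
def quadForm (B : Matrix (Fin N ⊕ Fin N) (Fin N ⊕ Fin N) ℝ) (x : PhaseSpace N) : ℝ :=
  flat x ⬝ᵥ (B *ᵥ flat x)

/-- The (unnormalised) centred Gaussian density `ρ_B(x) = e^{-x♭ᵀ B x♭ / 2}` with precision
matrix `B` (a probability density after normalisation iff `B` is positive definite; for the
stationary state of a linear Langevin system `B⁻¹` is the stationary covariance).
[Dhar 2008, §3.1 ("the steady state is given by the Gaussian distribution
`P = (2π)^{-N} Det[B̂]^{-1/2} e^{-½ qᵀ B̂⁻¹ q}`")] [cite: Dhar2008, §3.1] -/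
def gaussDensity (B : Matrix (Fin N ⊕ Fin N) (Fin N ⊕ Fin N) ℝ) (x : PhaseSpace N) : ℝ :=
  Real.exp (-(quadForm B x) / 2)

variable (B : Matrix (Fin N ⊕ Fin N) (Fin N ⊕ Fin N) ℝ)

/-- `ρ_B > 0`. [folklore] -/
theorem gaussDensity_pos (x : PhaseSpace N) : 0 < gaussDensity B x := Real.exp_pos _

/-- The quadratic form is continuous. [folklore] -/
theorem continuous_quadForm : Continuous (quadForm B : PhaseSpace N → ℝ) := by
  show Continuous fun x : PhaseSpace N => ∑ a, flat x a * (B *ᵥ flat x) a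
  exact continuous_finsetSum _ fun a _ =>
    (continuous_flat_apply a).mul (continuous_mulVec_flat_apply B a)

/-- `ρ_B` is continuous. [folklore] -/
theorem continuous_gaussDensity : Continuous (gaussDensity B : PhaseSpace N → ℝ) :=
  Real.continuous_exp.comp ((continuous_quadForm B).neg.div_const 2)

/-- Expansion of the quadratic form along a line, for symmetric `B`:
`(x + t v)♭ᵀ B (x + t v)♭ = x♭ᵀBx♭ + 2t v♭ᵀBx♭ + t² v♭ᵀBv♭`. [folklore] -/
theorem quadForm_add_smul (hB : Bᵀ = B) (x v : PhaseSpace N) (t : ℝ) :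
    quadForm B (x + t • v) = quadForm B x + 2 * t * (flat v ⬝ᵥ (B *ᵥ flat x)) + t ^ 2 * quadForm B v := by
  simp only [quadForm, flat_add, flat_smul, mulVec_add, mulVec_smul, add_dotProduct, dotProduct_add,
    smul_dotProduct, dotProduct_smul, smul_eq_mul]
  rw [dotProduct_mulVec_comm_of_transpose_eq hB (flat x) (flat v)]
  ring

/-- Line derivative of the quadratic form: `∂_v (x♭ᵀBx♭) = 2 v♭ᵀ B x♭` (`B` symmetric).
[folklore] -/
theorem hasLineDerivAt_quadForm (hB : Bᵀ = B) (x v : PhaseSpace N) :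
    HasLineDerivAt ℝ (quadForm B) (2 * (flat v ⬝ᵥ (B *ᵥ flat x))) x v := by
  unfold HasLineDerivAt
  have h : (fun t : ℝ => quadForm B (x + t • v)) =
      fun t => quadForm B x + 2 * t * (flat v ⬝ᵥ (B *ᵥ flat x)) + t ^ 2 * quadForm B v := by
    funext t; exact quadForm_add_smul B hB x v t
  rw [h]
  have h1 : HasDerivAt (fun t : ℝ => quadForm B x + 2 * t * (flat v ⬝ᵥ (B *ᵥ flat x)))
      (2 * 1 * (flat v ⬝ᵥ (B *ᵥ flat x))) 0 :=
    (((hasDerivAt_id' (0 : ℝ)).const_mul 2).mul_const _).const_add _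
  have h2 : HasDerivAt (fun t : ℝ => t ^ 2 * quadForm B v) ((2 : ℕ) * (0 : ℝ) ^ (2 - 1) * 1 * quadForm B v) 0 :=
    ((hasDerivAt_id' (0 : ℝ)).pow 2).mul_const _
  refine (h1.add h2).congr_deriv ?_
  norm_num

/-- Chain rule: `∂_v ρ_B = -(v♭ᵀ B x♭) ρ_B` (`B` symmetric). [folklore] -/
theorem hasLineDerivAt_gaussDensity (hB : Bᵀ = B) (x v : PhaseSpace N) :
    HasLineDerivAt ℝ (gaussDensity B) (-(flat v ⬝ᵥ (B *ᵥ flat x)) * gaussDensity B x) x v := by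
  have h := hasLineDerivAt_quadForm B hB x v
  unfold HasLineDerivAt at h ⊢
  unfold gaussDensity
  refine ((h.neg.div_const 2).exp).congr_deriv ?_
  simp only [Pi.neg_apply, zero_smul, add_zero]
  ring

/-- `∂_{E_c} ρ_B = -(B x♭)_c ρ_B` along a coordinate direction (`B` symmetric). [folklore] -/
theorem hasLineDerivAt_gaussDensity_coordVec (hB : Bᵀ = B) (x : PhaseSpace N) (c : Fin N ⊕ Fin N) :
    HasLineDerivAt ℝ (gaussDensity B) (-((B *ᵥ flat x) c) * gaussDensity B x) x (coordVec c) := by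
  have h := hasLineDerivAt_gaussDensity B hB x (coordVec c)
  rwa [flat_coordVec, single_dotProduct, one_mul] at h

/-- `∂_{q_i} ρ_B = -(B x♭)_{q_i} ρ_B`. [folklore] -/
theorem hasLineDerivAt_gaussDensity_unitQ (hB : Bᵀ = B) (x : PhaseSpace N) (i : Fin N) :
    HasLineDerivAt ℝ (gaussDensity B) (-((B *ᵥ flat x) (Sum.inl i)) * gaussDensity B x) x
      ((Pi.single i 1, 0) : PhaseSpace N) :=
  hasLineDerivAt_gaussDensity_coordVec B hB x (Sum.inl i)

/-- `∂_{p_i} ρ_B = -(B x♭)_{p_i} ρ_B`. [folklore] -/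
theorem hasLineDerivAt_gaussDensity_unitP (hB : Bᵀ = B) (x : PhaseSpace N) (i : Fin N) :
    HasLineDerivAt ℝ (gaussDensity B) (-((B *ᵥ flat x) (Sum.inr i)) * gaussDensity B x) x
      ((0, Pi.single i 1) : PhaseSpace N) :=
  hasLineDerivAt_gaussDensity_coordVec B hB x (Sum.inr i)

/-- `(B y♭)_{p_i}` has `p_i`-derivative `B_{p_i p_i}`. [folklore] -/
theorem hasLineDerivAt_mulVec_flat_inr (x : PhaseSpace N) (i : Fin N) :
    HasLineDerivAt ℝ (fun y : PhaseSpace N => (B *ᵥ flat y) (Sum.inr i)) (B (Sum.inr i) (Sum.inr i)) x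
      ((0, Pi.single i 1) : PhaseSpace N) :=
  hasLineDerivAt_mulVec_flat_apply B x (Sum.inr i) (Sum.inr i)

/-- `(B y♭)_{q_i}` does not depend on... rather: moving along `(0, e_i)` changes `(B y♭)_{a}` by
`t B_{a, p_i}`; in particular `(B (x + t(e_i,0))♭)_a = (Bx♭)_a + t B_{a q_i}`. [folklore] -/
theorem mulVec_flat_add_smul_coordVec (x : PhaseSpace N) (t : ℝ) (c a : Fin N ⊕ Fin N) :
    (B *ᵥ flat (x + t • coordVec c)) a = (B *ᵥ flat x) a + t * B a c := by
  rw [flat_add_smul_coordVec, mulVec_add, mulVec_smul, Pi.add_apply, Pi.smul_apply,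
    mulVec_single_one, smul_eq_mul]
  rfl

namespace OscillatorChain

variable (P : OscillatorChain)

/-! ### Integration by parts against `ρ_B` -/

/-- **Liouville part against a Gaussian density.** For `f ∈ C¹_c`, a symmetric `B` and every
site `i`,
`∫ (p_i ∂_{q_i} f - ∂_{q_i}H ∂_{p_i} f) ρ_B = ∫ (p_i (Bx♭)_{q_i} - ∂_{q_i}H (Bx♭)_{p_i}) ρ_B f`
(two integrations by parts, `∂_{q_i} ρ_B = -(Bx♭)_{q_i} ρ_B`, `∂_{p_i} ρ_B = -(Bx♭)_{p_i} ρ_B`,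
`∂_{q_i} p_i = 0 = ∂_{p_i} ∂_{q_i} H`). [Cuneo–Eckmann–Hairer–Rey-Bellet 2018, §3.1 (formal
adjoint `L*`)] [folklore] -/
theorem integral_liouville_mul_gaussDensity (hB : Bᵀ = B) (hU : ContDiff ℝ 1 P.U)
    (hV : ContDiff ℝ 1 P.V)
    {f : PhaseSpace N → ℝ} (hf : ContDiff ℝ 1 f) (hfc : HasCompactSupport f) (i : Fin N) :
    ∫ x, (x.2 i * partialQ i f x - partialQ i (P.hamiltonian N) x * partialP i f x) *
      gaussDensity B x =
    ∫ x, (x.2 i * (B *ᵥ flat x) (Sum.inl i) -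
      partialQ i (P.hamiltonian N) x * (B *ᵥ flat x) (Sum.inr i)) * gaussDensity B x * f x := by
  have hH1 : ContDiff ℝ 1 (P.hamiltonian N) := P.contDiff_hamiltonian hU hV N
  have hHd : Differentiable ℝ (P.hamiltonian N) := hH1.differentiable one_ne_zero
  have hfd : Differentiable ℝ f := hf.differentiable one_ne_zero
  have hρc : Continuous (gaussDensity B : PhaseSpace N → ℝ) := continuous_gaussDensity B
  have hWc : Continuous (partialQ i (P.hamiltonian N)) := P.continuous_partialQ_hamiltonian hH1 i
  have hQc : Continuous (partialQ i f) := continuous_partialQ hf one_ne_zero i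
  have hPc : Continuous (partialP i f) := continuous_partialP hf one_ne_zero i
  have hBq : Continuous fun x : PhaseSpace N => (B *ᵥ flat x) (Sum.inl i) :=
    continuous_mulVec_flat_apply B _
  have hBp : Continuous fun x : PhaseSpace N => (B *ᵥ flat x) (Sum.inr i) :=
    continuous_mulVec_flat_apply B _
  have hp2 : Continuous fun x : PhaseSpace N => x.2 i := (continuous_apply i).comp continuous_snd
  have e1 : ∫ x, (x.2 i * gaussDensity B x) * partialQ i f x =
      -∫ x, (x.2 i * (-((B *ᵥ flat x) (Sum.inl i)) * gaussDensity B x)) * f x := by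
    apply integral_mul_eq_neg_of_hasLineDerivAt (v := ((Pi.single i 1, 0) : PhaseSpace N))
    · exact hp2.mul hρc
    · exact hp2.mul (hBq.neg.mul hρc)
    · exact hf.continuous
    · exact hQc
    · exact hfc
    · exact hasCompactSupport_partialQ hfd hfc i
    · intro x
      have hρ' := hasLineDerivAt_gaussDensity_unitQ B hB x i
      unfold HasLineDerivAt at hρ' ⊢
      simp only [add_smul_unitQ_snd]
      exact hρ'.const_mul (x.2 i)
    · exact fun x => hasLineDerivAt_partialQ hfd i x
  have e2 : ∫ x, (partialQ i (P.hamiltonian N) x * gaussDensity B x) * partialP i f x =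
      -∫ x, (partialQ i (P.hamiltonian N) x * (-((B *ᵥ flat x) (Sum.inr i)) * gaussDensity B x)) *
        f x := by
    apply integral_mul_eq_neg_of_hasLineDerivAt (v := ((0, Pi.single i 1) : PhaseSpace N))
    · exact hWc.mul hρc
    · exact hWc.mul (hBp.neg.mul hρc)
    · exact hf.continuous
    · exact hPc
    · exact hfc
    · exact hasCompactSupport_partialP hfd hfc i
    · intro x
      have hρ' := hasLineDerivAt_gaussDensity_unitP B hB x i
      unfold HasLineDerivAt at hρ' ⊢
      simp only [partialQ_hamiltonian_add_smul_unitP]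
      exact hρ'.const_mul _
    · exact fun x => hasLineDerivAt_partialP hfd i x
  have hsplit : (fun x => (x.2 i * partialQ i f x -
      partialQ i (P.hamiltonian N) x * partialP i f x) * gaussDensity B x) =
      fun x => (x.2 i * gaussDensity B x) * partialQ i f x -
        (partialQ i (P.hamiltonian N) x * gaussDensity B x) * partialP i f x := by
    funext x; ring
  rw [hsplit, integral_sub, e1, e2, ← integral_neg, ← integral_neg, ← integral_sub]
  · refine integral_congr_ae (Filter.Eventually.of_forall fun x => ?_)
    simp only
    ring
  · exact ((hp2.mul (hBq.neg.mul hρc)).mul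
      hf.continuous).neg.integrable_of_hasCompactSupport hfc.mul_left.neg
  · exact ((hWc.mul (hBp.neg.mul hρc)).mul hf.continuous).neg.integrable_of_hasCompactSupport
      hfc.mul_left.neg
  · exact ((hp2.mul hρc).mul
      hQc).integrable_of_hasCompactSupport (hasCompactSupport_partialQ hfd hfc i).mul_left
  · exact ((hWc.mul hρc).mul hPc).integrable_of_hasCompactSupport
      (hasCompactSupport_partialP hfd hfc i).mul_left

/-- **Ornstein–Uhlenbeck (bath) part against a Gaussian density.** For a Langevin bath at
temperature `T_b` acting on `p_i`, `f ∈ C²_c` and symmetric `B`,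
`∫ (T_b ∂²_{p_i} f - p_i ∂_{p_i} f) ρ_B
  = ∫ (1 - p_i (Bx♭)_{p_i} - T_b (B_{p_i p_i} - (Bx♭)_{p_i}²)) ρ_B f`. [folklore] -/
theorem integral_bath_mul_gaussDensity (hB : Bᵀ = B) (T_b : ℝ)
    {f : PhaseSpace N → ℝ} (hf : ContDiff ℝ 2 f) (hfc : HasCompactSupport f) (i : Fin N) :
    ∫ x, (T_b * partialP i (partialP i f) x - x.2 i * partialP i f x) * gaussDensity B x =
      ∫ x, ((1 - x.2 i * (B *ᵥ flat x) (Sum.inr i)) -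
        T_b * (B (Sum.inr i) (Sum.inr i) - ((B *ᵥ flat x) (Sum.inr i)) ^ 2)) *
          gaussDensity B x * f x := by
  have hf1 : ContDiff ℝ 1 f := hf.of_le (by norm_num)
  have hfd : Differentiable ℝ f := hf.differentiable two_ne_zero
  have hg : ContDiff ℝ 1 (partialP i f) := contDiff_partialP hf (by norm_num) i
  have hgd : Differentiable ℝ (partialP i f) := hg.differentiable one_ne_zero
  have hgc : HasCompactSupport (partialP i f) := hasCompactSupport_partialP hfd hfc i
  have hg'c : HasCompactSupport (partialP i (partialP i f)) := hasCompactSupport_partialP hgd hgc i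
  have hgC : Continuous (partialP i f) := hg.continuous
  have hg'C : Continuous (partialP i (partialP i f)) := continuous_partialP hg one_ne_zero i
  have hρc : Continuous (gaussDensity B : PhaseSpace N → ℝ) := continuous_gaussDensity B
  have hBp : Continuous fun x : PhaseSpace N => (B *ᵥ flat x) (Sum.inr i) :=
    continuous_mulVec_flat_apply B _
  have hp2 : Continuous fun x : PhaseSpace N => x.2 i := (continuous_apply i).comp continuous_snd
  -- first integration by parts: `∫ ρ ∂²f = ∫ (Bx♭)_p ρ ∂f`
  have eA : ∫ x, gaussDensity B x * partialP i (partialP i f) x =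
      -∫ x, (-((B *ᵥ flat x) (Sum.inr i)) * gaussDensity B x) * partialP i f x := by
    apply integral_mul_eq_neg_of_hasLineDerivAt (v := ((0, Pi.single i 1) : PhaseSpace N)) hρc
      (hBp.neg.mul hρc) hgC hg'C hgc hg'c
    · exact fun x => hasLineDerivAt_gaussDensity_unitP B hB x i
    · exact fun x => hasLineDerivAt_partialP hgd i x
  -- second integration by parts: `∫ (Bx♭)_p ρ ∂f = -∫ (B_pp - (Bx♭)_p²) ρ f`
  have eB : ∫ x, ((B *ᵥ flat x) (Sum.inr i) * gaussDensity B x) * partialP i f x =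
      -∫ x, ((B (Sum.inr i) (Sum.inr i) - ((B *ᵥ flat x) (Sum.inr i)) ^ 2) * gaussDensity B x) *
        f x := by
    apply integral_mul_eq_neg_of_hasLineDerivAt (v := ((0, Pi.single i 1) : PhaseSpace N))
      (hBp.mul hρc) ((continuous_const.sub (hBp.pow 2)).mul hρc) hf.continuous hgC hfc hgc
    · intro x
      have h1 := hasLineDerivAt_mulVec_flat_inr B x i
      have h2 := hasLineDerivAt_gaussDensity_unitP B hB x i
      refine (h1.mul h2).congr_deriv ?_
      simp only [Pi.mul_apply, Pi.sub_apply, Pi.pow_apply, zero_smul, add_zero]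
      ring
    · exact fun x => hasLineDerivAt_partialP hfd i x
  -- the friction term: `∫ p ρ ∂f = -∫ (1 - p (Bx♭)_p) ρ f`
  have eC : ∫ x, (x.2 i * gaussDensity B x) * partialP i f x =
      -∫ x, ((1 - x.2 i * (B *ᵥ flat x) (Sum.inr i)) * gaussDensity B x) * f x := by
    apply integral_mul_eq_neg_of_hasLineDerivAt (v := ((0, Pi.single i 1) : PhaseSpace N))
      (hp2.mul hρc) ((continuous_const.sub (hp2.mul hBp)).mul hρc) hf.continuous hgC hfc hgc
    · intro x
      have h1 : HasLineDerivAt ℝ (fun y : PhaseSpace N => y.2 i) 1 x ((0, Pi.single i 1) : PhaseSpace N) := by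
        have := hasLineDerivAt_flat_apply x (Sum.inr i) (Sum.inr i)
        simpa using this
      have h2 := hasLineDerivAt_gaussDensity_unitP B hB x i
      refine (h1.mul h2).congr_deriv ?_
      simp only [Pi.mul_apply, Pi.sub_apply, zero_smul, add_zero]
      ring
    · exact fun x => hasLineDerivAt_partialP hfd i x
  have hsplit : (fun x => (T_b * partialP i (partialP i f) x - x.2 i * partialP i f x) *
      gaussDensity B x) = fun x => T_b * (gaussDensity B x * partialP i (partialP i f) x) -
        (x.2 i * gaussDensity B x) * partialP i f x := by
    funext x; ring
  have eA' : ∫ x, gaussDensity B x * partialP i (partialP i f) x =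
      -∫ x, ((B (Sum.inr i) (Sum.inr i) - ((B *ᵥ flat x) (Sum.inr i)) ^ 2) * gaussDensity B x) *
        f x := by
    rw [eA, ← eB, ← integral_neg]
    refine integral_congr_ae (Filter.Eventually.of_forall fun x => ?_)
    simp only
    ring
  -- integrability of the pieces
  have hint1 : Integrable (fun x => (1 - x.2 i * (B *ᵥ flat x) (Sum.inr i)) * gaussDensity B x * f x) :=
    (((continuous_const.sub (hp2.mul hBp)).mul hρc).mul hf.continuous).integrable_of_hasCompactSupport
      hfc.mul_left
  have hint2 : Integrable (fun x => (B (Sum.inr i) (Sum.inr i) - ((B *ᵥ flat x) (Sum.inr i)) ^ 2) *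
      gaussDensity B x * f x) :=
    (((continuous_const.sub (hBp.pow 2)).mul hρc).mul hf.continuous).integrable_of_hasCompactSupport
      hfc.mul_left
  have hint3 : Integrable (fun x => T_b * (gaussDensity B x * partialP i (partialP i f) x)) :=
    ((hρc.mul hg'C).integrable_of_hasCompactSupport hg'c.mul_left).const_mul T_b
  have hint4 : Integrable (fun x => (x.2 i * gaussDensity B x) * partialP i f x) :=
    ((hp2.mul hρc).mul hgC).integrable_of_hasCompactSupport hgc.mul_left
  have hR : ∫ x, ((1 - x.2 i * (B *ᵥ flat x) (Sum.inr i)) -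
        T_b * (B (Sum.inr i) (Sum.inr i) - ((B *ᵥ flat x) (Sum.inr i)) ^ 2)) *
          gaussDensity B x * f x =
      (∫ x, (1 - x.2 i * (B *ᵥ flat x) (Sum.inr i)) * gaussDensity B x * f x) -
        T_b * ∫ x, (B (Sum.inr i) (Sum.inr i) - ((B *ᵥ flat x) (Sum.inr i)) ^ 2) *
          gaussDensity B x * f x := by
    rw [← integral_const_mul, ← integral_sub hint1 (hint2.const_mul T_b)]
    refine integral_congr_ae (Filter.Eventually.of_forall fun x => ?_)
    simp only
    ring
  rw [hR, hsplit, integral_sub hint3 hint4, integral_const_mul, eA', eC]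
  ring

/-- The polynomial `L*_B := ρ_B⁻¹ L* ρ_B` obtained by applying the formal adjoint of the
generator `L_{T_L,T_R}` to the Gaussian density `ρ_B`:
`∑_i (p_i (Bx♭)_{q_i} - ∂_{q_i}H (Bx♭)_{p_i})
  + γ ∑_i ([i=0](1 - p_i (Bx♭)_{p_i} - T_L(B_{p_ip_i} - (Bx♭)²_{p_i})) + [i=N-1](… T_R …))`.
[folklore] -/
def adjointPoly (T_L T_R : ℝ) (x : PhaseSpace N) : ℝ :=
  (∑ i : Fin N, (x.2 i * (B *ᵥ flat x) (Sum.inl i) -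
    partialQ i (P.hamiltonian N) x * (B *ᵥ flat x) (Sum.inr i))) +
  P.γ * ∑ i : Fin N,
    ((if i.val = 0 then (1 - x.2 i * (B *ᵥ flat x) (Sum.inr i)) -
        T_L * (B (Sum.inr i) (Sum.inr i) - ((B *ᵥ flat x) (Sum.inr i)) ^ 2) else 0) +
      (if i.val = N - 1 then (1 - x.2 i * (B *ᵥ flat x) (Sum.inr i)) -
        T_R * (B (Sum.inr i) (Sum.inr i) - ((B *ᵥ flat x) (Sum.inr i)) ^ 2) else 0))

/-- The adjoint polynomial is continuous (for `C¹` potentials). [folklore] -/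
theorem continuous_adjointPoly (hU : ContDiff ℝ 1 P.U) (hV : ContDiff ℝ 1 P.V)
    (T_L T_R : ℝ) : Continuous (P.adjointPoly B T_L T_R) := by
  have hH1 : ContDiff ℝ 1 (P.hamiltonian N) := P.contDiff_hamiltonian hU hV N
  have hWc : ∀ i, Continuous (partialQ i (P.hamiltonian N)) := fun i =>
    P.continuous_partialQ_hamiltonian hH1 i
  have hB : ∀ a, Continuous fun x : PhaseSpace N => (B *ᵥ flat x) a :=
    fun a => continuous_mulVec_flat_apply B a
  unfold adjointPoly
  refine (continuous_finsetSum _ fun i _ => ?_).add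
    (continuous_const.mul (continuous_finsetSum _ fun i _ => ?_))
  · exact (((continuous_apply i).comp continuous_snd).mul (hB _)).sub
      ((hWc i).mul (hB _))
  · refine Continuous.add ?_ ?_ <;> split_ifs
    · exact (continuous_const.sub (((continuous_apply i).comp continuous_snd).mul
        (hB _))).sub (continuous_const.mul (continuous_const.sub ((hB _).pow 2)))
    · exact continuous_const
    · exact (continuous_const.sub (((continuous_apply i).comp continuous_snd).mul
        (hB _))).sub (continuous_const.mul (continuous_const.sub ((hB _).pow 2)))
    · exact continuous_const

/-- **The generator against a Gaussian density.** For `f ∈ C²_c`, symmetric `B` and any bath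
temperatures, `∫ (L_{T_L,T_R} f) ρ_B = ∫ (L*_B) ρ_B f` with the explicit quadratic polynomial
`L*_B = adjointPoly`: the measure `ρ_B dq dp` is weakly stationary iff `∫ (L*_B) ρ_B f = 0` for all
test functions, e.g. if `L*_B ≡ 0`. [Cuneo–Eckmann–Hairer–Rey-Bellet 2018, §3.1 ("invariance …
can be seen by checking that `L* ρ = 0`")] [folklore] -/
theorem integral_generator_mul_gaussDensity (hB : Bᵀ = B) (hU : ContDiff ℝ 1 P.U)
    (hV : ContDiff ℝ 1 P.V)
    (T_L T_R : ℝ) {f : PhaseSpace N → ℝ} (hf : ContDiff ℝ 2 f) (hfc : HasCompactSupport f) :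
    ∫ x, P.generator N T_L T_R f x * gaussDensity B x =
      ∫ x, P.adjointPoly B T_L T_R x * gaussDensity B x * f x := by
  have hf1 : ContDiff ℝ 1 f := hf.of_le (by norm_num)
  have hfd : Differentiable ℝ f := hf.differentiable two_ne_zero
  have hH1 : ContDiff ℝ 1 (P.hamiltonian N) := P.contDiff_hamiltonian hU hV N
  have hρc : Continuous (gaussDensity B : PhaseSpace N → ℝ) := continuous_gaussDensity B
  have hBc : ∀ a, Continuous fun x : PhaseSpace N => (B *ᵥ flat x) a :=
    fun a => continuous_mulVec_flat_apply B a
  -- regularity of the pieces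
  have hQc : ∀ i, Continuous (partialQ i f) := fun i => continuous_partialQ hf1 one_ne_zero i
  have hPc : ∀ i, Continuous (partialP i f) := fun i => continuous_partialP hf1 one_ne_zero i
  have hP1 : ∀ i, ContDiff ℝ 1 (partialP i f) := fun i => contDiff_partialP hf (by norm_num) i
  have hPPc : ∀ i, Continuous (partialP i (partialP i f)) := fun i =>
    continuous_partialP (hP1 i) one_ne_zero i
  have hQs : ∀ i, HasCompactSupport (partialQ i f) := fun i => hasCompactSupport_partialQ hfd hfc i
  have hPs : ∀ i, HasCompactSupport (partialP i f) := fun i => hasCompactSupport_partialP hfd hfc i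
  have hPPs : ∀ i, HasCompactSupport (partialP i (partialP i f)) := fun i =>
    hasCompactSupport_partialP ((hP1 i).differentiable one_ne_zero) (hPs i) i
  have hWc : ∀ i, Continuous (partialQ i (P.hamiltonian N)) := fun i =>
    P.continuous_partialQ_hamiltonian hH1 i
  -- the right-hand side integrands
  set liou : Fin N → PhaseSpace N → ℝ := fun i x => (x.2 i * (B *ᵥ flat x) (Sum.inl i) -
    partialQ i (P.hamiltonian N) x * (B *ᵥ flat x) (Sum.inr i)) with hliou
  set bath : ℝ → Fin N → PhaseSpace N → ℝ := fun Tb i x => (1 - x.2 i * (B *ᵥ flat x) (Sum.inr i)) -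
    Tb * (B (Sum.inr i) (Sum.inr i) - ((B *ᵥ flat x) (Sum.inr i)) ^ 2) with hbath
  have hliou_c : ∀ i, Continuous (liou i) := fun i =>
    (((continuous_apply i).comp continuous_snd).mul (hBc _)).sub ((hWc i).mul (hBc _))
  have hbath_c : ∀ Tb i, Continuous (bath Tb i) := fun Tb i =>
    (continuous_const.sub (((continuous_apply i).comp continuous_snd).mul
      (hBc _))).sub (continuous_const.mul (continuous_const.sub ((hBc _).pow 2)))
  -- integrability of the three families of terms (left-hand side)
  have hp2 : ∀ i, Continuous fun x : PhaseSpace N => x.2 i := fun i =>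
    (continuous_apply i).comp continuous_snd
  have intA : ∀ i, Integrable (fun x => (x.2 i * partialQ i f x -
      partialQ i (P.hamiltonian N) x * partialP i f x) * gaussDensity B x) := by
    intro i
    refine Continuous.integrable_of_hasCompactSupport
      ((((hp2 i).mul (hQc i)).sub ((hWc i).mul (hPc i))).mul hρc) ?_
    exact (((hQs i).mul_left (f := fun x : PhaseSpace N => x.2 i)).sub
      ((hPs i).mul_left)).mul_right
  have intB : ∀ (i : Fin N) (c : Prop) [Decidable c] (Tb : ℝ), Integrable (fun x =>
      (if c then Tb * partialP i (partialP i f) x - x.2 i * partialP i f x else 0) *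
        gaussDensity B x) := by
    intro i c _ Tb
    by_cases hc : c
    · simp only [hc, if_true]
      refine Continuous.integrable_of_hasCompactSupport
        (((continuous_const.mul (hPPc i)).sub ((hp2 i).mul (hPc i))).mul hρc) ?_
      exact (((hPPs i).mul_left).sub ((hPs i).mul_left)).mul_right
    · simp only [hc, if_false, zero_mul]
      exact integrable_zero _ _ _
  have intBC : ∀ i : Fin N, Integrable (fun x =>
      (if i.val = 0 then T_L * partialP i (partialP i f) x - x.2 i * partialP i f x else 0) *
          gaussDensity B x +
        (if i.val = N - 1 then T_R * partialP i (partialP i f) x - x.2 i * partialP i f x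
          else 0) * gaussDensity B x) :=
    fun i => (intB i _ T_L).add (intB i _ T_R)
  -- integrability (right-hand side)
  have intA' : ∀ i, Integrable (fun x => liou i x * gaussDensity B x * f x) := fun i =>
    (((hliou_c i).mul hρc).mul hf.continuous).integrable_of_hasCompactSupport hfc.mul_left
  have intB2 : ∀ (i : Fin N) (c : Prop) [Decidable c] (Tb : ℝ), Integrable (fun x =>
      (if c then bath Tb i x else 0) * gaussDensity B x * f x) := by
    intro i c _ Tb
    by_cases hc : c
    · simp only [hc, if_true]
      exact (((hbath_c Tb i).mul hρc).mul hf.continuous).integrable_of_hasCompactSupport hfc.mul_left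
    · simp only [hc, if_false, zero_mul]
      exact integrable_zero _ _ _
  have intBC' : ∀ i : Fin N, Integrable (fun x =>
      (if i.val = 0 then bath T_L i x else 0) * gaussDensity B x * f x +
        (if i.val = N - 1 then bath T_R i x else 0) * gaussDensity B x * f x) :=
    fun i => (intB2 i _ T_L).add (intB2 i _ T_R)
  -- values of the bath terms
  have valB : ∀ (i : Fin N) (c : Prop) [Decidable c] (Tb : ℝ), ∫ x,
      (if c then Tb * partialP i (partialP i f) x - x.2 i * partialP i f x else 0) *
        gaussDensity B x = ∫ x, (if c then bath Tb i x else 0) * gaussDensity B x * f x := by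
    intro i c _ Tb
    by_cases hc : c
    · simp only [hc, if_true]
      exact integral_bath_mul_gaussDensity B hB Tb hf hfc i
    · simp only [hc, if_false, zero_mul, integral_zero]
  -- pointwise splitting of the integrands
  have hsplit : (fun x => P.generator N T_L T_R f x * gaussDensity B x) = fun x =>
      (∑ i : Fin N, (x.2 i * partialQ i f x - partialQ i (P.hamiltonian N) x * partialP i f x) *
        gaussDensity B x) +
      P.γ * ∑ i : Fin N,
        ((if i.val = 0 then T_L * partialP i (partialP i f) x - x.2 i * partialP i f x else 0) *
            gaussDensity B x +
          (if i.val = N - 1 then T_R * partialP i (partialP i f) x - x.2 i * partialP i f x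
            else 0) * gaussDensity B x) := by
    funext x
    simp only [generator, add_mul, Finset.sum_mul, mul_assoc]
  have hsplit' : (fun x => P.adjointPoly B T_L T_R x * gaussDensity B x * f x) = fun x =>
      (∑ i : Fin N, liou i x * gaussDensity B x * f x) +
      P.γ * ∑ i : Fin N,
        ((if i.val = 0 then bath T_L i x else 0) * gaussDensity B x * f x +
          (if i.val = N - 1 then bath T_R i x else 0) * gaussDensity B x * f x) := by
    funext x
    simp only [adjointPoly, hliou, hbath, add_mul, Finset.sum_mul, mul_assoc]
  -- per-site values of the bath sums
  have hLi : ∀ i : Fin N, ∫ x,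
      ((if i.val = 0 then T_L * partialP i (partialP i f) x - x.2 i * partialP i f x else 0) *
          gaussDensity B x +
        (if i.val = N - 1 then T_R * partialP i (partialP i f) x - x.2 i * partialP i f x
          else 0) * gaussDensity B x) =
      (∫ x, (if i.val = 0 then bath T_L i x else 0) * gaussDensity B x * f x) +
        ∫ x, (if i.val = N - 1 then bath T_R i x else 0) * gaussDensity B x * f x := by
    intro i
    rw [integral_add (intB i _ T_L) (intB i _ T_R), valB, valB]
  have hRi : ∀ i : Fin N, ∫ x,
      ((if i.val = 0 then bath T_L i x else 0) * gaussDensity B x * f x +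
        (if i.val = N - 1 then bath T_R i x else 0) * gaussDensity B x * f x) =
      (∫ x, (if i.val = 0 then bath T_L i x else 0) * gaussDensity B x * f x) +
        ∫ x, (if i.val = N - 1 then bath T_R i x else 0) * gaussDensity B x * f x :=
    fun i => integral_add (intB2 i _ T_L) (intB2 i _ T_R)
  have hL : ∫ x, P.generator N T_L T_R f x * gaussDensity B x =
      (∑ i : Fin N, ∫ x, liou i x * gaussDensity B x * f x) +
      P.γ * ∑ i : Fin N, ((∫ x, (if i.val = 0 then bath T_L i x else 0) * gaussDensity B x * f x) +
        ∫ x, (if i.val = N - 1 then bath T_R i x else 0) * gaussDensity B x * f x) := by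
    rw [hsplit, integral_add (integrable_finsetSum _ fun i _ => intA i)
      ((integrable_finsetSum _ fun i _ => intBC i).const_mul _), integral_const_mul,
      integral_finsetSum _ fun i _ => intA i, integral_finsetSum _ fun i _ => intBC i]
    congr 1
    · exact Finset.sum_congr rfl fun i _ =>
        P.integral_liouville_mul_gaussDensity B hB hU hV hf1 hfc i
    · congr 1
      exact Finset.sum_congr rfl fun i _ => hLi i
  have hR : ∫ x, P.adjointPoly B T_L T_R x * gaussDensity B x * f x =
      (∑ i : Fin N, ∫ x, liou i x * gaussDensity B x * f x) +
      P.γ * ∑ i : Fin N, ((∫ x, (if i.val = 0 then bath T_L i x else 0) * gaussDensity B x * f x) +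
        ∫ x, (if i.val = N - 1 then bath T_R i x else 0) * gaussDensity B x * f x) := by
    rw [hsplit', integral_add (integrable_finsetSum _ fun i _ => intA' i)
      ((integrable_finsetSum _ fun i _ => intBC' i).const_mul _), integral_const_mul,
      integral_finsetSum _ fun i _ => intA' i, integral_finsetSum _ fun i _ => intBC' i]
    congr 1
    congr 1
    exact Finset.sum_congr rfl fun i _ => hRi i
  rw [hL, hR]

end OscillatorChain

end Literature.MathematicalPhysics.KineticTheory.HeatConduction
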